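import Summits.NavierStokesRegularity.NavierStokesRegularity.Theorems.EfficiencyFloorEnstrophyBudget
import Summits.NavierStokesRegularity.NavierStokesRegularity.Theorems.EfficiencyFloorBlowupEnstrophyUnbounded
import Summits.NavierStokesRegularity.NavierStokesRegularity.Theorems.EfficiencyFloorProductionEfficiencyDecayEfficiencyConcentration
import Summits.NavierStokesRegularity.NavierStokesRegularity.Theorems.EfficiencyFloorProductionEfficiencyDecayReduction
import Summits.NavierStokesRegularity.NavierStokesRegularity.Theorems.EfficiencyFloorProductionEfficiencyDecayViolationAlgebra
import Summits.NavierStokesRegularity.NavierStokesRegularity.Theses.EfficiencyFloor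
import Literature.Analysis.FluidPDE.NSLerayBlowupRateEnstrophy
import Literature.Analysis.FluidPDE.TaoEnstrophyLocalisationProofs
import Literature.Analysis.FluidPDE.BKMClassEnstrophyContinuity
import HarnessLib

/-!
# Crux `EfficiencyFloor.ProductionEfficiencyDecay` (stmt-NavierStokesRegularity-22866): STRUCTURE AT A
# VIOLATION TIME — where the pointwise efficiency law can fail, the flow is near-extremal and its enstrophy
# concentrates in ONE ball of parabolic radius `O(√(T−t))`

`--supports stmt-NavierStokesRegularity-22866 --as helper` (line `efficiency_floor`; seat ns-ef-p4). The planner's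
foreseen split `EnstrophyBudget → ScaleOrDepletion → ProductionEfficiencyDecay` (route rationale, TWO-LAYER PLAN),
made quantitative and chained to the landed structural lemma `EfficiencyConcentration` (stmt-23111).

SETTING. The registered crux-proper stub S2 (`stub_depletionGivenBudget`) asks, along a maximal smooth Leray–Hopf
rapidly-decaying-datum solution with budget triple `(Z, Pal, S)` (`Ż = 2S − 2ν·Pal`, `|S| ≤ c Z^{3/4} Pal^{3/4}`,
the landed stmt-22995), that for every `ε > 0` eventually `Ż ≤ ε Z³`. Call `t` an `ε`-VIOLATION TIME if
`ε Z(t)³ < 2S(t) − 2ν·Pal(t)`.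

WHAT IS PROVED (unconditional):
* §1 (Part I, `…ViolationAlgebra.lean`, pure algebra at one instant): at an `ε`-violation time `Z, Pal > 0`, the
  palinstrophy ratio is in the LU–DOERING WINDOW `Z³ < (2c/ε)^{4/3}·Pal`, `Pal < (c/ν)⁴·Z³`, the stretching is
  UNIFORMLY EFFICIENT `θ Z^{3/4} Pal^{3/4} ≤ S`, `θ(ν,ε) = (4ν/3)^{3/4}(2ε)^{1/4}`, and `(Z/Pal)^{1/2} ≤ (2c/ε)^{2/3}/Z`.
* §2 `concentration_at_violation`: for all `c, ν, ε > 0` there are `R, δ > 0` such that at every `ε`-violation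
  time `t ∈ (0,T)` of every such solution some ball of radius `R / Z(t)` carries `≥ δ Z(t)` of the enstrophy
  `∫|curl u(t)|²` (apply stmt-23111 — through the registered stub `stub_efficiencyConcentration` landed by the lead — to `v = u(t)`; the regularity of the slice comes from the Tao-class cover, as in
  the landed budget file).
* §3 `parabolic_concentration_at_violation`: by Leray's floor `Z(t) ≥ c_L ν^{3/2}/√(T−t)` (tree:
  `leray_blowup_rate_enstrophy`) the radius is PARABOLIC, `R/Z(t) ≤ R' √(T−t)`, and the captured mass is
  `≥ δ Z(t) ≥ δ c_L ν^{3/2} (T−t)^{−1/2}`: the Barker–Prange scale-invariant enstrophy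
  `√(T−t) ∫_{B(a, R'√(T−t))} |ω|²` is bounded BELOW by `δ c_L ν^{3/2}` at every violation time
  ([corpus:paper:arxiv-2211.16215 §7.2]: this is exactly their 'initial concentration' quantity).
* §5 `depletion_or_frequent_concentration` (appended): the same as a dichotomy in Barker–Prange form — for each
  `ε`, either S2 holds at level `ε` or, frequently as `t ↑ T`, `√(T−t)∫_{B(a,R'√(T−t))}|ω|² ≥ γ = δ c_L ν^{3/2}`.
* §4 `depletion_of_noParabolicConcentration` / `productionEfficiencyDecay_of_noParabolicConcentration`:
  contrapositive packaging — S2's conclusion for a solution (hence, through the lead's landed reduction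
  `productionEfficiencyDecay_of_depletion`, the crux BY NAME if assumed for all solutions) follows from ASYMPTOTIC
  NON-CONCENTRATION AT THE PARABOLIC SCALE: for all `R, δ > 0`, eventually as `t ↑ T` no ball of radius `R√(T−t)`
  holds `δ Z(t)` of enstrophy.

WHAT THIS SAYS ABOUT THE CRUX. Failure of pointwise efficiency decay is confined to instants at which the flow is
(i) in the compact Lu–Doering window of palinstrophy ratios, (ii) `θ(ν,ε)`-efficient, and (iii) concentrated:
a fixed fraction of an enstrophy `≳ (T−t)^{−1/2}` inside one parabolic ball. A Leray-rate / Type-I blow-up is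
expected to do exactly this (Barker–Prange concentration near Type-I singularities), consistent with the lead's
`Negative/…FalseOfLerayRateBlowup`; the sufficient condition of §4 is therefore NOT claimed to be provable — it
is the precise non-concentration statement the crux reduces to on this line. S2 itself stays open-problem grade.

HONEST FRAMING: structure lemmas about a HYPOTHETICAL blow-up; the crux stmt-22866 is NOT proved; nothing about
NS regularity is asserted; no summit is proved.

References: L. Lu, C. R. Doering, Indiana Univ. Math. J. 57 (2008) 2693–2727; T. Barker, C. Prange, Comm. Math.
Phys. 385 (2021) 717–792 (arXiv:2003.06717) and the survey arXiv:2211.16215 §7.2; J. Leray, Acta Math. 63 (1934).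
[folklore]
-/

-- the problem directory repeats the summit name (`NavierStokesRegularity/NavierStokesRegularity`)
set_option linter.dupNamespace false

noncomputable section

open Set Filter MeasureTheory Topology Function
open scoped InnerProductSpace ENNReal NNReal ContDiff
open Literature.Analysis.FluidPDE

namespace Summit.NavierStokesRegularity.NavierStokesRegularity.Theorems

namespace ProductionEfficiencyDecay

namespace Violation

/-- **Slice regularity and the identification of the budget triple** at a time `t ∈ (0,T)`: the slice `u t` is
smooth, divergence-free, `H²`, and `Zr t = ∫‖curl u(t)‖²` (real Bochner integral). [cite: Tao2011, Cor. 11.1] -/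
theorem slice_data {ν T : ℝ} (hν : 0 < ν) (hT : 0 < T)
    {u : ℝ → EuclideanSpace ℝ (Fin 3) → EuclideanSpace ℝ (Fin 3)} {p : ℝ → EuclideanSpace ℝ (Fin 3) → ℝ}
    (hmax : IsMaximalSmoothSolution ν 0 u p T) (hLH : IsLerayHopfOn T ν 0 (u 0) u)
    (hdec : HasRapidSpatialDecay (u 0)) {Zr : ℝ → ℝ} {t : ℝ} (ht : t ∈ Ioo 0 T)
    (hZ : ∫⁻ x, ‖curl (u t) x‖ₑ ^ 2 = ENNReal.ofReal (Zr t)) (hZ0 : 0 ≤ Zr t) :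
    ContDiff ℝ (⊤ : ℕ∞) (u t) ∧ VectorCalculus.IsDivFree (u t) ∧
      (∀ n : ℕ, ∫⁻ x, ‖iteratedFDeriv ℝ n (u t) x‖ₑ ^ 2 < ⊤) ∧ Zr t = ∫ x, ‖curl (u t) x‖ ^ 2 := by
  have htI : t ∈ Ico 0 T := ⟨ht.1.le, ht.2⟩
  have hsol := hmax.isClassicalNSSolutionOn
  have hsm : ContDiff ℝ ∞ (u t) := hsol.contDiff_velocity htI
  have hLS := EnstrophyBudget.isLocalSolution hν hT hsol hLH hdec
  have hn : ∀ n : ℕ, ∫⁻ x, ‖iteratedFDeriv ℝ n (u t) x‖ₑ ^ 2 < ⊤ := EnstrophyBudget.sobolev_slice hLS htI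
  refine ⟨hsm, hsol.divFree t htI, hn, ?_⟩
  have h1 := lintegral_enorm_curl_sq_eq_ofReal_integral (hsm.of_le (by norm_cast)) (hn 1)
  rw [hZ] at h1
  exact (ENNReal.ofReal_eq_ofReal_iff hZ0 (integral_nonneg fun x => by positivity)).1 h1

/-- **CONCENTRATION AT A VIOLATION TIME.** For all `c, ν, ε > 0` there are `R, δ > 0` such that along every
maximal smooth Leray–Hopf rapidly-decaying-datum solution on `[0,T)` with budget triple `(Zr, Pr, Sr)` (clauses of
the registered stub S2, verbatim) and at every `ε`-violation time `t ∈ (0,T)` (`ε Zr(t)³ < 2Sr(t) − 2ν Pr(t)`),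
some ball of radius `R / Zr(t)` carries at least `δ Zr(t)` of the enstrophy:
`δ Zr(t) ≤ ∫_{B(a, R/Zr t)} ‖curl u(t)‖²`. (`R = K·(2c/ε)^{2/3}` and `δ` with `K, δ` from stmt-23111 at efficiency `ε' = θ(ν,ε) = (4ν/3)^{3/4}(2ε)^{1/4}`.)
[folklore] -/
theorem concentration_at_violation :
    ∀ (c ν ε : ℝ), 0 < c → 0 < ν → 0 < ε → ∃ R δ : ℝ, 0 < R ∧ 0 < δ ∧ ∀ (T : ℝ), 0 < T →
      ∀ (u : ℝ → EuclideanSpace ℝ (Fin 3) → EuclideanSpace ℝ (Fin 3)) (p : ℝ → EuclideanSpace ℝ (Fin 3) → ℝ),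
        Literature.Analysis.FluidPDE.IsMaximalSmoothSolution ν 0 u p T →
        Literature.Analysis.FluidPDE.IsLerayHopfOn T ν 0 (u 0) u →
        Literature.Analysis.FluidPDE.HasRapidSpatialDecay (u 0) →
        ∀ (Zr Pr Sr : ℝ → ℝ), (∀ t ∈ Set.Ioo 0 T,
          ∫⁻ x, ‖Literature.Analysis.FluidPDE.curl (u t) x‖ₑ ^ 2 = ENNReal.ofReal (Zr t) ∧ 0 ≤ Zr t ∧
          0 ≤ Pr t ∧
          Pr t = ∫ x, Literature.Analysis.FluidPDE.frobeniusNormSq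
            (fderiv ℝ (Literature.Analysis.FluidPDE.curl (u t)) x) ∧
          Sr t = ∫ x, ⟪Literature.Analysis.FluidPDE.curl (u t) x,
            fderiv ℝ (u t) x (Literature.Analysis.FluidPDE.curl (u t) x)⟫_ℝ ∧
          HasDerivAt Zr (2 * Sr t - 2 * ν * Pr t) t ∧
          |Sr t| ≤ c * Zr t ^ (3 / 4 : ℝ) * Pr t ^ (3 / 4 : ℝ)) →
        ∀ t ∈ Set.Ioo 0 T, ε * Zr t ^ 3 < 2 * Sr t - 2 * ν * Pr t →
          ∃ a : EuclideanSpace ℝ (Fin 3),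
            δ * Zr t ≤ ∫ x in Metric.ball a (R / Zr t), ‖Literature.Analysis.FluidPDE.curl (u t) x‖ ^ 2 := by
  intro c ν ε hc hν hε
  -- the structural lemma stmt-23111 at efficiency `θ(ν,ε)`
  obtain ⟨K, δ, hK, hδ, hcon⟩ := stub_efficiencyConcentration _ (theta_pos hν hε)
  refine ⟨K * (2 * c / ε) ^ (2 / 3 : ℝ), δ, by positivity, hδ, ?_⟩
  intro T hT u p hmax hLH hdec Zr Pr Sr hB t ht hv
  obtain ⟨hZeq, hZ0, hP0, hPeq, hSeq, -, hS⟩ := hB t ht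
  obtain ⟨hsm, hdiv, hn, hZint⟩ := slice_data hν hT hmax hLH hdec ht hZeq hZ0
  have hZp : 0 < Zr t := enstrophy_pos hν hZ0 hP0 hS hv
  have hPp : 0 < Pr t := palinstrophy_pos hν hε hZ0 hP0 hS hv
  have heff := efficient hν hε hZ0 hP0 hv
  have hrad := sqrt_ratio_le hν hε hZ0 hP0 hS hv
  have h0 : ∫⁻ x, ‖iteratedFDeriv ℝ 0 (u t) x‖ₑ ^ 2 < ⊤ := hn 0
  -- apply stmt-23111 to the slice
  rw [hZint] at hZp heff hrad
  rw [hPeq] at hPp heff hrad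
  rw [hSeq] at heff
  obtain ⟨a, ha⟩ := hcon (u t) hsm hdiv h0 (hn 1) (hn 2) hZp hPp heff
  refine ⟨a, ?_⟩
  rw [hZint]
  refine ha.trans ?_
  -- enlarge the ball: `K (Z/Pal)^{1/2} ≤ K (2c/ε)^{2/3} / Z`
  have hsub : Metric.ball a (K * Real.sqrt ((∫ x, ‖curl (u t) x‖ ^ 2) /
      ∫ x, frobeniusNormSq (fderiv ℝ (curl (u t)) x))) ⊆
      Metric.ball a (K * (2 * c / ε) ^ (2 / 3 : ℝ) / ∫ x, ‖curl (u t) x‖ ^ 2) := by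
    apply Metric.ball_subset_ball
    rw [mul_div_assoc]
    exact mul_le_mul_of_nonneg_left hrad hK.le
  have hint : Integrable (fun x => ‖curl (u t) x‖ ^ 2) :=
    (integrable_norm_curl_sq (hsm.of_le (by norm_cast)) (hn 1)).1
  exact setIntegral_mono_set hint.integrableOn (ae_of_all _ fun x => by positivity)
    (ae_of_all _ hsub)

/-! ### §3 The radius is parabolic -/

/-- **Leray's floor in real form**: along a maximal smooth Leray–Hopf rapidly-decaying-datum solution, any real
enstrophy function with `∫⁻‖curl u(t)‖ₑ² = ofReal (Zr t)` satisfies `c_L ν^{3/2} (T−t)^{−1/2} ≤ Zr t` on `(0,T)`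
(`c_L` the tree's universal Leray constant: `leray_blowup_rate_enstrophy` + the Tao-class sub-slab bound +
`∫|∇u|²_F ≤ ∫|curl u|²`). [cite: RobinsonRodrigoSadowski2016, Lemma 6.13] -/
theorem leray_floor_real :
    ∃ cL : ℝ, 0 < cL ∧ ∀ (ν T : ℝ), 0 < ν → 0 < T →
      ∀ (u : ℝ → EuclideanSpace ℝ (Fin 3) → EuclideanSpace ℝ (Fin 3)) (p : ℝ → EuclideanSpace ℝ (Fin 3) → ℝ),
        Literature.Analysis.FluidPDE.IsMaximalSmoothSolution ν 0 u p T →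
        Literature.Analysis.FluidPDE.IsLerayHopfOn T ν 0 (u 0) u →
        Literature.Analysis.FluidPDE.HasRapidSpatialDecay (u 0) →
        ∀ (Zr : ℝ → ℝ), (∀ t ∈ Set.Ioo 0 T,
          ∫⁻ x, ‖Literature.Analysis.FluidPDE.curl (u t) x‖ₑ ^ 2 = ENNReal.ofReal (Zr t) ∧ 0 ≤ Zr t) →
        ∀ t ∈ Set.Ioo 0 T, cL * ν ^ (3 / 2 : ℝ) * (T - t) ^ (-(1 / 2 : ℝ)) ≤ Zr t := by
  obtain ⟨cL, hcL, hrate⟩ := leray_blowup_rate_enstrophy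
  refine ⟨cL, hcL, ?_⟩
  intro ν T hν hT u p hmax hLH hdec Zr hZ t ht
  have htI : t ∈ Ico 0 T := ⟨ht.1.le, ht.2⟩
  have hsol := hmax.isClassicalNSSolutionOn
  have hfloor := hrate ν T hν hT u p hmax hLH
    (BlowupEnstrophyUnbounded.eLpNorm_uncurry_top_lt_top hν hT hsol hLH hdec) t htI
  have hL2 : ∫⁻ x, ‖u t x‖ₑ ^ 2 < ⊤ :=
    (hLH.lintegral_enorm_sq_le hν.le ⟨htI.1, htI.2.le⟩).trans_lt ENNReal.ofReal_lt_top
  have hcurl := lintegral_frobeniusNormSq_fderiv_le_lintegral_sq_norm_curl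
    ((hsol.contDiff_velocity htI).of_le (by norm_cast)) (hsol.divFree t htI) hL2
  have h := (hfloor.trans hcurl)
  rw [(hZ t ht).1, ENNReal.ofReal_le_ofReal_iff (hZ t ht).2] at h
  exact h

/-- **PARABOLIC CONCENTRATION AT A VIOLATION TIME.** For all `c, ν, ε > 0` there are `R', δ > 0` such that along
every maximal smooth Leray–Hopf rapidly-decaying-datum solution on `[0,T)` with budget triple `(Zr, Pr, Sr)` and at
every `ε`-violation time `t ∈ (0,T)`, some ball of PARABOLIC radius `R' √(T−t)` carries at least `δ Zr(t)` of the
enstrophy — where moreover `Zr(t) ≥ c_L ν^{3/2}/√(T−t)` (Leray), so the Barker–Prange scale-invariant enstrophy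
`√(T−t) ∫_{B(a,R'√(T−t))} |ω|²` is at least `δ c_L ν^{3/2}` there. [folklore] -/
theorem parabolic_concentration_at_violation :
    ∀ (c ν ε : ℝ), 0 < c → 0 < ν → 0 < ε → ∃ R' δ : ℝ, 0 < R' ∧ 0 < δ ∧ ∀ (T : ℝ), 0 < T →
      ∀ (u : ℝ → EuclideanSpace ℝ (Fin 3) → EuclideanSpace ℝ (Fin 3)) (p : ℝ → EuclideanSpace ℝ (Fin 3) → ℝ),
        Literature.Analysis.FluidPDE.IsMaximalSmoothSolution ν 0 u p T →
        Literature.Analysis.FluidPDE.IsLerayHopfOn T ν 0 (u 0) u →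
        Literature.Analysis.FluidPDE.HasRapidSpatialDecay (u 0) →
        ∀ (Zr Pr Sr : ℝ → ℝ), (∀ t ∈ Set.Ioo 0 T,
          ∫⁻ x, ‖Literature.Analysis.FluidPDE.curl (u t) x‖ₑ ^ 2 = ENNReal.ofReal (Zr t) ∧ 0 ≤ Zr t ∧
          0 ≤ Pr t ∧
          Pr t = ∫ x, Literature.Analysis.FluidPDE.frobeniusNormSq
            (fderiv ℝ (Literature.Analysis.FluidPDE.curl (u t)) x) ∧
          Sr t = ∫ x, ⟪Literature.Analysis.FluidPDE.curl (u t) x,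
            fderiv ℝ (u t) x (Literature.Analysis.FluidPDE.curl (u t) x)⟫_ℝ ∧
          HasDerivAt Zr (2 * Sr t - 2 * ν * Pr t) t ∧
          |Sr t| ≤ c * Zr t ^ (3 / 4 : ℝ) * Pr t ^ (3 / 4 : ℝ)) →
        ∀ t ∈ Set.Ioo 0 T, ε * Zr t ^ 3 < 2 * Sr t - 2 * ν * Pr t →
          ∃ a : EuclideanSpace ℝ (Fin 3),
            δ * Zr t ≤ ∫ x in Metric.ball a (R' * Real.sqrt (T - t)),
              ‖Literature.Analysis.FluidPDE.curl (u t) x‖ ^ 2 := by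
  intro c ν ε hc hν hε
  obtain ⟨R, δ, hR, hδ, hcon⟩ := concentration_at_violation c ν ε hc hν hε
  obtain ⟨cL, hcL, hfl⟩ := leray_floor_real
  refine ⟨R / (cL * ν ^ (3 / 2 : ℝ)), δ, by positivity, hδ, ?_⟩
  intro T hT u p hmax hLH hdec Zr Pr Sr hB t ht hv
  obtain ⟨a, ha⟩ := hcon T hT u p hmax hLH hdec Zr Pr Sr hB t ht hv
  obtain ⟨hZeq, hZ0, hP0, -, -, -, hS⟩ := hB t ht
  have hZp : 0 < Zr t := enstrophy_pos hν hZ0 hP0 hS hv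
  have hfloor := hfl ν T hν hT u p hmax hLH hdec Zr (fun s hs => ⟨(hB s hs).1, (hB s hs).2.1⟩) t ht
  have hTt : 0 < T - t := sub_pos.2 ht.2
  have hA : 0 < cL * ν ^ (3 / 2 : ℝ) := by positivity
  -- `R / Zr t ≤ (R/(c_L ν^{3/2})) √(T−t)`
  have hrad : R / Zr t ≤ R / (cL * ν ^ (3 / 2 : ℝ)) * Real.sqrt (T - t) := by
    have h1 : cL * ν ^ (3 / 2 : ℝ) ≤ Zr t * Real.sqrt (T - t) := by
      rw [Real.rpow_neg hTt.le, ← Real.sqrt_eq_rpow] at hfloor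
      have hs : 0 < Real.sqrt (T - t) := Real.sqrt_pos.2 hTt
      have := mul_le_mul_of_nonneg_right hfloor hs.le
      rwa [mul_assoc, inv_mul_cancel₀ hs.ne', mul_one] at this
    rw [div_mul_eq_mul_div, div_le_div_iff₀ hZp (by positivity)]
    calc R * (cL * ν ^ (3 / 2 : ℝ)) ≤ R * (Zr t * Real.sqrt (T - t)) :=
          mul_le_mul_of_nonneg_left h1 hR.le
      _ = R * Real.sqrt (T - t) * Zr t := by ring
  refine ⟨a, ha.trans ?_⟩
  obtain ⟨hsm, -, hn, -⟩ := slice_data hν hT hmax hLH hdec ht hZeq hZ0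
  have hint : Integrable (fun x => ‖curl (u t) x‖ ^ 2) :=
    (integrable_norm_curl_sq (hsm.of_le (by norm_cast)) (hn 1)).1
  exact setIntegral_mono_set hint.integrableOn (ae_of_all _ fun x => by positivity)
    (ae_of_all _ (Metric.ball_subset_ball hrad))

/-! ### §4 Contrapositive: the crux proper from asymptotic non-concentration at the parabolic scale -/

/-- **S2 from non-concentration.** Along a maximal smooth Leray–Hopf rapidly-decaying-datum solution with budget
triple `(Zr, Pr, Sr)`: if for all `R, δ > 0`, eventually as `t ↑ T` NO ball of radius `R√(T−t)` holds `δ Zr(t)` of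
the enstrophy, then the conclusion of the registered crux-proper stub S2 holds for this solution — for every
`ε > 0`, eventually `0 < Zr` and `2Sr − 2ν Pr ≤ ε Zr³`. The hypothesis is NOT claimed to be provable (a Type-I
blow-up is expected to violate it); this is the non-concentration statement the crux reduces to on this line.
[folklore] -/
theorem depletion_of_noParabolicConcentration {c ν T : ℝ} (hc : 0 < c) (hν : 0 < ν) (hT : 0 < T)
    {u : ℝ → EuclideanSpace ℝ (Fin 3) → EuclideanSpace ℝ (Fin 3)} {p : ℝ → EuclideanSpace ℝ (Fin 3) → ℝ}
    (hmax : IsMaximalSmoothSolution ν 0 u p T) (hLH : IsLerayHopfOn T ν 0 (u 0) u)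
    (hdec : HasRapidSpatialDecay (u 0)) {Zr Pr Sr : ℝ → ℝ}
    (hB : (∀ t ∈ Set.Ioo 0 T,
      ∫⁻ x, ‖Literature.Analysis.FluidPDE.curl (u t) x‖ₑ ^ 2 = ENNReal.ofReal (Zr t) ∧ 0 ≤ Zr t ∧
      0 ≤ Pr t ∧
      Pr t = ∫ x, Literature.Analysis.FluidPDE.frobeniusNormSq
        (fderiv ℝ (Literature.Analysis.FluidPDE.curl (u t)) x) ∧
      Sr t = ∫ x, ⟪Literature.Analysis.FluidPDE.curl (u t) x,
        fderiv ℝ (u t) x (Literature.Analysis.FluidPDE.curl (u t) x)⟫_ℝ ∧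
      HasDerivAt Zr (2 * Sr t - 2 * ν * Pr t) t ∧
      |Sr t| ≤ c * Zr t ^ (3 / 4 : ℝ) * Pr t ^ (3 / 4 : ℝ)))
    (hNC : ∀ R δ : ℝ, 0 < R → 0 < δ → ∀ᶠ t in 𝓝[<] T, ∀ a : EuclideanSpace ℝ (Fin 3),
      ∫ x in Metric.ball a (R * Real.sqrt (T - t)), ‖curl (u t) x‖ ^ 2 < δ * Zr t) :
    ∀ ε : ℝ, 0 < ε → ∃ t₁ ∈ Set.Ioo 0 T, ∀ t ∈ Set.Ico t₁ T, 0 < Zr t ∧ 2 * Sr t - 2 * ν * Pr t ≤ ε * Zr t ^ 3 := by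
  intro ε hε
  obtain ⟨R', δ, hR', hδ, hcon⟩ := parabolic_concentration_at_violation c ν ε hc hν hε
  -- eventually: no concentrated ball, and `Zr ≥ 1`
  have h1 := hNC R' δ hR' hδ
  have h2 := BlowupEnstrophyUnbounded.main hν hT hmax hLH hdec 1
  have h3 : ∀ᶠ t in 𝓝[<] T, t ∈ Ioo 0 T := Ioo_mem_nhdsLT hT
  obtain ⟨t₀, ht₀T, hsub⟩ := mem_nhdsLT_iff_exists_Ioo_subset.1 (h1.and (h2.and h3))
  set t₁ : ℝ := (max t₀ 0 + T) / 2 with ht₁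
  have hm : max t₀ 0 < T := max_lt ht₀T hT
  have ht₁I : t₁ ∈ Ioo 0 T := ⟨by rw [ht₁]; linarith [le_max_right t₀ 0], by rw [ht₁]; linarith⟩
  refine ⟨t₁, ht₁I, fun t ht => ?_⟩
  have ht₀t : t₀ < t := by
    have : max t₀ 0 < t₁ := by rw [ht₁]; linarith
    exact (le_max_left t₀ 0).trans_lt (this.trans_le ht.1)
  obtain ⟨hnc, hone, htI⟩ := hsub ⟨ht₀t, ht.2⟩
  have hZ1 : 1 ≤ Zr t := by
    rw [(hB t htI).1, ENNReal.ofReal_le_ofReal_iff'] at hone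
    rcases hone with h | h
    · exact h
    · exact absurd h (by norm_num)
  have hZp : 0 < Zr t := one_pos.trans_le hZ1
  refine ⟨hZp, ?_⟩
  by_contra hv
  rw [not_le] at hv
  obtain ⟨a, ha⟩ := hcon T hT u p hmax hLH hdec Zr Pr Sr hB t htI hv
  exact absurd (hnc a) (not_lt.2 ha)

/-- **The crux BY NAME from parabolic non-concentration** (through the lead's landed reduction
`productionEfficiencyDecay_of_depletion`): if along EVERY maximal smooth Leray–Hopf rapidly-decaying-datum solution
and every real enstrophy function `Zr` (`∫⁻‖curl u(t)‖ₑ² = ofReal (Zr t)` on `(0,T)`) the enstrophy does NOT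
concentrate at the parabolic scale (for all `R, δ > 0`, eventually no ball of radius `R√(T−t)` holds `δ Zr(t)`),
then `EfficiencyFloor.ProductionEfficiencyDecay`. A CONDITIONAL: the hypothesis is a non-concentration statement of
open-problem grade, NOT proved anywhere; nothing about NS regularity is asserted. [folklore] -/
theorem productionEfficiencyDecay_of_noParabolicConcentration
    (hNC : ∀ (ν T : ℝ), 0 < ν → 0 < T →
      ∀ (u : ℝ → EuclideanSpace ℝ (Fin 3) → EuclideanSpace ℝ (Fin 3)) (p : ℝ → EuclideanSpace ℝ (Fin 3) → ℝ),
        Literature.Analysis.FluidPDE.IsMaximalSmoothSolution ν 0 u p T →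
        Literature.Analysis.FluidPDE.IsLerayHopfOn T ν 0 (u 0) u →
        Literature.Analysis.FluidPDE.HasRapidSpatialDecay (u 0) →
        ∀ (Zr : ℝ → ℝ), (∀ t ∈ Set.Ioo 0 T,
          ∫⁻ x, ‖Literature.Analysis.FluidPDE.curl (u t) x‖ₑ ^ 2 = ENNReal.ofReal (Zr t)) →
        ∀ R δ : ℝ, 0 < R → 0 < δ → ∀ᶠ t in 𝓝[<] T, ∀ a : EuclideanSpace ℝ (Fin 3),
          ∫ x in Metric.ball a (R * Real.sqrt (T - t)), ‖Literature.Analysis.FluidPDE.curl (u t) x‖ ^ 2 <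
            δ * Zr t) :
    Summit.NavierStokesRegularity.NavierStokesRegularity.Theses.EfficiencyFloor.ProductionEfficiencyDecay := by
  refine productionEfficiencyDecay_of_depletion ?_
  intro c ν T hc hν hT u p hmax hLH hdec Zr Pr Sr hB ε hε
  exact depletion_of_noParabolicConcentration hc hν hT hmax hLH hdec hB
    (hNC ν T hν hT u p hmax hLH hdec Zr fun t ht => (hB t ht).1) ε hε


/-! ### §5 The dichotomy in Barker–Prange form -/

/-- **DEPLETION OR FREQUENT SCALE-INVARIANT CONCENTRATION.** For all `c, ν, ε > 0` there are `R', γ > 0`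
(`γ = δ·c_L·ν^{3/2}`) such that along every maximal smooth Leray–Hopf rapidly-decaying-datum solution on `[0,T)`
with budget triple `(Zr, Pr, Sr)`: EITHER the conclusion of the registered crux-proper stub S2 holds at level `ε`
(a late window on which `0 < Zr` and `2Sr − 2ν Pr ≤ ε Zr³`), OR, frequently as `t ↑ T`, the Barker–Prange
scale-invariant enstrophy of some parabolic ball is at least `γ`:
`γ ≤ √(T−t) · ∫_{B(a, R'√(T−t))} ‖curl u(t)‖²` ([corpus:paper:arxiv-2211.16215 §7.2], their 'initial
concentration'). Neither branch is asserted for any actual solution; the crux is NOT proved. [folklore] -/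
theorem depletion_or_frequent_concentration :
    ∀ (c ν ε : ℝ), 0 < c → 0 < ν → 0 < ε → ∃ R' γ : ℝ, 0 < R' ∧ 0 < γ ∧ ∀ (T : ℝ), 0 < T →
      ∀ (u : ℝ → EuclideanSpace ℝ (Fin 3) → EuclideanSpace ℝ (Fin 3)) (p : ℝ → EuclideanSpace ℝ (Fin 3) → ℝ),
        Literature.Analysis.FluidPDE.IsMaximalSmoothSolution ν 0 u p T →
        Literature.Analysis.FluidPDE.IsLerayHopfOn T ν 0 (u 0) u →
        Literature.Analysis.FluidPDE.HasRapidSpatialDecay (u 0) →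
        ∀ (Zr Pr Sr : ℝ → ℝ), (∀ t ∈ Set.Ioo 0 T,
          ∫⁻ x, ‖Literature.Analysis.FluidPDE.curl (u t) x‖ₑ ^ 2 = ENNReal.ofReal (Zr t) ∧ 0 ≤ Zr t ∧
          0 ≤ Pr t ∧
          Pr t = ∫ x, Literature.Analysis.FluidPDE.frobeniusNormSq
            (fderiv ℝ (Literature.Analysis.FluidPDE.curl (u t)) x) ∧
          Sr t = ∫ x, ⟪Literature.Analysis.FluidPDE.curl (u t) x,
            fderiv ℝ (u t) x (Literature.Analysis.FluidPDE.curl (u t) x)⟫_ℝ ∧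
          HasDerivAt Zr (2 * Sr t - 2 * ν * Pr t) t ∧
          |Sr t| ≤ c * Zr t ^ (3 / 4 : ℝ) * Pr t ^ (3 / 4 : ℝ)) →
        (∃ t₁ ∈ Set.Ioo 0 T, ∀ t ∈ Set.Ico t₁ T, 0 < Zr t ∧ 2 * Sr t - 2 * ν * Pr t ≤ ε * Zr t ^ 3) ∨
        (∃ᶠ t in 𝓝[<] T, ∃ a : EuclideanSpace ℝ (Fin 3),
          γ ≤ Real.sqrt (T - t) *
            ∫ x in Metric.ball a (R' * Real.sqrt (T - t)), ‖Literature.Analysis.FluidPDE.curl (u t) x‖ ^ 2) := by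
  intro c ν ε hc hν hε
  obtain ⟨R', δ, hR', hδ, hcon⟩ := parabolic_concentration_at_violation c ν ε hc hν hε
  obtain ⟨cL, hcL, hfl⟩ := leray_floor_real
  refine ⟨R', δ * (cL * ν ^ (3 / 2 : ℝ)), hR', by positivity, ?_⟩
  intro T hT u p hmax hLH hdec Zr Pr Sr hB
  by_cases hfreq : ∃ᶠ t in 𝓝[<] T, ε * Zr t ^ 3 < 2 * Sr t - 2 * ν * Pr t
  · right
    have hIoo : ∀ᶠ t in 𝓝[<] T, t ∈ Ioo 0 T := Ioo_mem_nhdsLT hT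
    refine (hfreq.and_eventually hIoo).mono ?_
    rintro t ⟨hv, ht⟩
    obtain ⟨a, ha⟩ := hcon T hT u p hmax hLH hdec Zr Pr Sr hB t ht hv
    refine ⟨a, ?_⟩
    have hfloor := hfl ν T hν hT u p hmax hLH hdec Zr (fun s hs => ⟨(hB s hs).1, (hB s hs).2.1⟩) t ht
    have hTt : 0 < T - t := sub_pos.2 ht.2
    have hs : 0 < Real.sqrt (T - t) := Real.sqrt_pos.2 hTt
    have h1 : cL * ν ^ (3 / 2 : ℝ) ≤ Zr t * Real.sqrt (T - t) := by
      rw [Real.rpow_neg hTt.le, ← Real.sqrt_eq_rpow] at hfloor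
      have := mul_le_mul_of_nonneg_right hfloor hs.le
      rwa [mul_assoc, inv_mul_cancel₀ hs.ne', mul_one] at this
    calc δ * (cL * ν ^ (3 / 2 : ℝ)) ≤ δ * (Zr t * Real.sqrt (T - t)) := mul_le_mul_of_nonneg_left h1 hδ.le
      _ = Real.sqrt (T - t) * (δ * Zr t) := by ring
      _ ≤ Real.sqrt (T - t) * ∫ x in Metric.ball a (R' * Real.sqrt (T - t)), ‖curl (u t) x‖ ^ 2 :=
          mul_le_mul_of_nonneg_left ha hs.le
  · left
    rw [Filter.not_frequently] at hfreq
    -- eventually: no violation, `Zr ≥ 1`, `t ∈ (0,T)`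
    have h2 := BlowupEnstrophyUnbounded.main hν hT hmax hLH hdec 1
    have h3 : ∀ᶠ t in 𝓝[<] T, t ∈ Ioo 0 T := Ioo_mem_nhdsLT hT
    obtain ⟨t₀, ht₀T, hsub⟩ := mem_nhdsLT_iff_exists_Ioo_subset.1 (hfreq.and (h2.and h3))
    set t₁ : ℝ := (max t₀ 0 + T) / 2 with ht₁
    have hm : max t₀ 0 < T := max_lt ht₀T hT
    have ht₁I : t₁ ∈ Ioo 0 T := ⟨by rw [ht₁]; linarith [le_max_right t₀ 0], by rw [ht₁]; linarith⟩
    refine ⟨t₁, ht₁I, fun t ht => ?_⟩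
    have ht₀t : t₀ < t := by
      have : max t₀ 0 < t₁ := by rw [ht₁]; linarith
      exact (le_max_left t₀ 0).trans_lt (this.trans_le ht.1)
    obtain ⟨hnv, hone, htI⟩ := hsub ⟨ht₀t, ht.2⟩
    have hZ1 : 1 ≤ Zr t := by
      rw [(hB t htI).1, ENNReal.ofReal_le_ofReal_iff'] at hone
      rcases hone with h | h
      · exact h
      · exact absurd h (by norm_num)
    exact ⟨one_pos.trans_le hZ1, not_lt.1 hnv⟩

end Violation

end ProductionEfficiencyDecay

end Summit.NavierStokesRegularity.NavierStokesRegularity.Theorems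

end
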